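import Summits.RiemannHypothesis.RiemannHypothesis.Theorems.HandoffSemilocalEnergy
import Summits.RiemannHypothesis.RiemannHypothesis.Theorems.SoloInformedGroundStateDecay2
import HarnessLib

/-!
# HANDOFF — the near-null bottom of the deprived form `{p < q}` on its window is FORCED, RH-free (kernel form of prove-1 ATTEMPT-7 §4.5)

Cell `rh-explicit`, TRACK «HANDOFF», seat handoff-prove-1 (gen4).  A three-line bridge between two tree theorems:
* theory-2's LOCALITY `semilocalGroundEnergy_old_cone` (`HandoffSemilocalEnergy.lean`): on the old cone `b ≤ (log q)/2` the
  `{p < q}`-form's continuum bottom IS Weil's ground energy, `λ_min(S_q; b) = ε(b)`, and `semilocalGroundEnergy_top_anti`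
  (the bottom is non-increasing in the window);
* the Solo programme's UNCONDITIONAL doubly-exponential thinness `weilGroundEnergy_exp_exp_decay`
  (`SoloInformedGroundStateDecay2.lean`, claim C28): `ε(a) ≤ C·exp(−c·e^{2a})` for `a ≥ 1`, absolute `c > 0`, `C`, NO hypothesis on zeros.
Consequence (`semilocalGroundEnergy_primesBelow_le_exp_neg`, `aggregateDeficit_ge_neg_exp`): for every prime `q ≥ 8` (so
`(log q)/2 ≥ 1`) and every window `t ≥ (log q)/2` — in particular on the whole handoff window `W_q = ((log q)/2, (log q⁺)/2]` —

  `λ_min({p < q}; t) ≤ C·e^{−c q}`,  i.e.  `D_q(t) ≥ −C·e^{−c q}`: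

the deprived form can never be MORE than doubly-exponentially positive on its window; the exponentially near-null bottom that the
cell observes for the `S_{<q}`-forms (idea-3 K-F6, conj-1 m_E, prove-1 ATTEMPT-7 §4.5 / ATTEMPT-8) is a theorem of zero COUNTING,
with no RH content.  What RH adds is only the SIGN (`D_q ≤ cap(q) − ε`, `HandoffLoadCeiling.lean`) — the handoff inequality itself.
The paper versions (ATTEMPT-7 Thm B, ATTEMPT-8 Thm B♯) give the explicit rate `c = 4e(1 − o(1))` and in-range numbers; this file is
the qualitative statement in the kernel (the Solo constant `c` is ineffective: `fdX` is a `Classical.choose`).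

HONEST FRAMING: nothing here bears on the truth of RH; it is a NEGATIVE-information theorem (the LEVEL of the near-null bottom of the
deprived form is not RH-evidence).  References: this track HANDOFF-STATEMENT §D/§H.3; Solo programme claim C28; Bombieri 2000 §4
[Bombieri2000Weil]; Connes–Consani 2023 §2.2–2.4 [ConnesConsani2023].
-/

set_option linter.dupNamespace false  -- the mandated namespace repeats `RiemannHypothesis`

noncomputable section

open Real Literature.NumberTheory.LFunctions
open Summit.RiemannHypothesis.RiemannHypothesis.Theorems

namespace Summit.RiemannHypothesis.RiemannHypothesis.Theorems.HandoffSemilocalEnergy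

/-- `(log q)/2 ≥ 1` as soon as `q ≥ 8` (`e² < 7.39`). [folklore] -/
theorem one_le_log_div_two_of_eight_le {q : ℕ} (hq : 8 ≤ q) : 1 ≤ Real.log q / 2 := by
  have hq' : (8 : ℝ) ≤ q := by exact_mod_cast hq
  have he : Real.exp 1 < 2.7182818286 := Real.exp_one_lt_d9
  have h2 : Real.exp 2 ≤ (q : ℝ) := by
    have : Real.exp 2 = Real.exp 1 * Real.exp 1 := by rw [← Real.exp_add]; norm_num
    rw [this]
    nlinarith [Real.exp_pos 1]
  have := Real.log_le_log (Real.exp_pos 2) h2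
  rw [Real.log_exp] at this
  linarith

/-- **The deprived form's bottom is doubly-exponentially small on and beyond its cone, RH-free**: there are absolute `c > 0`, `C`
with `λ_min({p < q}; t) ≤ C·e^{−cq}` for every prime `q ≥ 8` and every `t ≥ (log q)/2` (monotonicity in the window + locality
`λ_min(S_q; (log q)/2) = ε((log q)/2)` + the Solo programme's unconditional `ε(a) ≤ C exp(−c e^{2a})`).
[this track: prove-1 ATTEMPT-7 §4.5 (paper, explicit rate 4e); kernel inputs `semilocalGroundEnergy_old_cone`, `weilGroundEnergy_exp_exp_decay`] -/
theorem semilocalGroundEnergy_primesBelow_le_exp_neg :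
    ∃ c : ℝ, 0 < c ∧ ∃ C : ℝ, ∀ q : ℕ, q.Prime → 8 ≤ q → ∀ t : ℝ, Real.log q / 2 ≤ t →
      semilocalGroundEnergy (Nat.primesBelow q) (fun _ ↦ True) t ≤ C * Real.exp (-c * q) := by
  obtain ⟨c, hc, C, hC⟩ := weilGroundEnergy_exp_exp_decay
  refine ⟨c, hc, C, fun q hq h8 t ht ↦ ?_⟩
  have h1 : 1 ≤ Real.log q / 2 := one_le_log_div_two_of_eight_le h8
  have hb : 0 < Real.log q / 2 := by linarith
  have hq0 : (0 : ℝ) < q := by exact_mod_cast hq.pos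
  calc semilocalGroundEnergy (Nat.primesBelow q) (fun _ ↦ True) t
      ≤ semilocalGroundEnergy (Nat.primesBelow q) (fun _ ↦ True) (Real.log q / 2) :=
        semilocalGroundEnergy_top_anti _ hb ht
    _ = weilGroundEnergy (Real.log q / 2) := semilocalGroundEnergy_old_cone hq le_rfl
    _ ≤ C * Real.exp (-c * Real.exp (2 * (Real.log q / 2))) := hC _ h1
    _ = C * Real.exp (-c * q) := by
        rw [show 2 * (Real.log q / 2) = Real.log q by ring, Real.exp_log hq0]

/-- The same in the track's deficit language: **`D_q(t) ≥ −C·e^{−cq}` for every prime `q ≥ 8` and `t ≥ (log q)/2`** — in particular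
on the whole handoff window `((log q)/2, (log q⁺)/2]` the aggregate deficit of the `{p < q}`-form is bounded BELOW by a
doubly-exponentially small negative number, unconditionally (its sign and its upper bound `cap(q) − ε` are where RH lives).
[this track: prove-1 ATTEMPT-7 §4.5 / ATTEMPT-8; HANDOFF-STATEMENT §D] -/
theorem aggregateDeficit_ge_neg_exp :
    ∃ c : ℝ, 0 < c ∧ ∃ C : ℝ, ∀ q : ℕ, q.Prime → 8 ≤ q → ∀ t : ℝ, Real.log q / 2 ≤ t →
      -(C * Real.exp (-c * q)) ≤ aggregateDeficit q t := by
  obtain ⟨c, hc, C, hC⟩ := semilocalGroundEnergy_primesBelow_le_exp_neg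
  refine ⟨c, hc, C, fun q hq h8 t ht ↦ ?_⟩
  have := hC q hq h8 t ht
  unfold aggregateDeficit
  linarith

end Summit.RiemannHypothesis.RiemannHypothesis.Theorems.HandoffSemilocalEnergy

end
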